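import Summits.Ventures.LatticeQCDFlow.Scaling.EntryGraphRotation
import Summits.Ventures.LatticeQCDFlow.Scaling.DominatedStarRegimeFreeGap

/-!
HONEST FRAMING: exact (Metropolis-corrected) sampling algorithms for lattice gauge theory; figures
of merit are autocorrelation/cost numbers at stated couplings and volumes; no continuum-physics
claim.

# EntryGraphRegimeFreeGap — EVERY EXCHANGE SCHEME WHOSE PROPOSAL LAW LISTS EACH HUB EDGE `(0, k+1)` AT LEAST `c` TIMES AMONG `m`
# ENTRIES — ANY OTHER PAIRS, ANY PER-ENTRY MAPS — HAS, WITH NO REGIME, `Gap ≥ p·min{ct/(3m), γ₀(1−t)w_0/(7K)}`, IS IRREDUCIBLE AS SOON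
# AS ITS HOT UPDATE IS, AND `τ_int(g) ≤ 1/(p·min{…}) − ½` FOR EVERY OBSERVABLE (lean-2 GEN-28, ours)

Venture-side (OURS).  Cell `lqcd-flow` (pub-lqcd), unit `pub-lqcd-lean-2-g28`, 2026-08-28.  Chapter N, file 11: `Scaling/DominatedStarRegimeFreeGap`
(N2) and `Scaling/DominatedStarRegimeFreeAutocorrelation` (N3) for a general edge list `e : Fin m → (Fin (K+1))²` (distinct endpoints) with
maps `φ : Fin m → Equiv.Perm S`: the scheme `P = t·ptGraphSwap μ e φ + (1−t)·prodKernel w M` — replica exchange on an arbitrary swap graph,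
with transports on every edge, the hot level refreshed by a sampler of Poincaré constant `γ₀`.  The variance inequality of
`Scaling/EntryGraphRotation` (N10) uses the hub entries only; the swap Dirichlet form is the sum of ALL entry energies
(`ptGraph_dirichletForm_swap_eq_min`); so the extra edges enter the floor only through the list length `m` (dilution), exactly as in
chapter K's identity-map law (`Scaling/SwapGraphDilution`), now with per-entry maps and one-sided transported domination on the hub entries.

## What is proved

* **`entryGraph_poincare`** — `C·Var_π̃(f) ≤ 𝓔_P(f)` whenever `C·3m ≤ pct` and `C(p + 6K) ≤ pγ₀(1−t)w_0`;
  **`entryGraph_spectralGap_ge`** — **`Gap ≥ p·min{ct/(3m), γ₀(1−t)w_0/(7K)}`** (`K ≥ 1`, `p ≤ 1`, `|S| ≥ 2`; hot update `μ_0`-reversible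
  with Poincaré constant `γ₀`, cold updates `μ_k`-reversible; every hub edge listed `≥ c ≥ 1` times with `p·μ_{k+1}(φ_r u) ≤ μ_0(u)` there).
* **`entryGraph_isIrreducible_of_hot`** — hot update irreducible, `0 < t < 1`, `w_0 > 0`, every hub edge listed: irreducible (cold updates
  arbitrary; the other edges and all maps arbitrary).
* **`entryGraph_tauInt_le`** — `τ_int(g) ≤ 1/(p·min{ct/(3m), γ₀(1−t)w_0/(7K)}) − ½` for every non-constant observable;
  `exactEntryGraph_spectralGap_ge`, `exactEntryGraph_tauInt_le` — the exact hot sampler (`γ₀ = 1`).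

Reading (no numerics implied): whatever pairs of replicas a tempering scheme proposes to exchange, and through whatever learned maps,
its quadratic figures of merit are at least those of its hub sub-law diluted to the full list: `min{(hub multiplicity)·t/(3m),
γ₀(1−t)w_0/(7K)}` times `p`.  NOT CLAIMED: credit for cold–cold edges; the `log K` mixing time (item 1); anything measured.  Literature
grade (cell rule): OWN RESULT on N2/N3/N10; nothing cited as a fact; no new bib keys.
-/

noncomputable section

open Finset Function
open Literature.Probability.MarkovChains

namespace Summit.Ventures.LatticeQCDFlow.Scaling

variable {S : Type*} [Fintype S] [DecidableEq S] {K m : ℕ} {μ : Fin (K + 1) → S → ℝ} {M : Fin (K + 1) → S → S → ℝ}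
  {w : Fin (K + 1) → ℝ} {t p : ℝ}

section Graph
variable (e : Fin m → Fin (K + 1) × Fin (K + 1)) (φ : Fin m → Equiv.Perm S)

/-! ## §1 The regime-free Poincaré inequality and gap on an arbitrary swap graph -/

/-- **THE REGIME-FREE POINCARÉ INEQUALITY ON A SWAP GRAPH WITH PER-ENTRY MAPS** (edge list with distinct endpoints listing every hub edge
`(0, k+1)` at least `c ≥ 1` times; one-sided transported domination on those entries; hot Poincaré constant `γ₀`; `0 < t < 1`, `w ≥ 0`,
`w_0 > 0`; cold updates arbitrary transition matrices): `C·Var_π̃(f) ≤ 𝓔_P(f)` for `C·3m ≤ pct`, `C(p + 6K) ≤ pγ₀(1−t)w_0`. [ours] -/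
theorem entryGraph_poincare (hm : 1 ≤ m) (he : ∀ r, (e r).1 ≠ (e r).2) (hμ : ∀ k x, 0 < μ k x) (hμ1 : ∀ k, ∑ u, μ k u = 1)
    (hM : ∀ k, IsRowStochastic (M k)) (hw0 : ∀ k, 0 ≤ w k) (hwhot : 0 < w 0) (ht0 : 0 < t) (ht1 : t < 1)
    {γ₀ : ℝ} (hp : 0 < p) (hγ₀ : 0 < γ₀)
    (hdom : ∀ (r : Fin m) (k : Fin K), e r = ((0 : Fin (K + 1)), k.succ) → ∀ u : S, p * μ k.succ (φ r u) ≤ μ 0 u)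
    (hgap0 : ∀ h : S → ℝ, γ₀ * lawVariance (μ 0) h ≤ dirichletForm (μ 0) (M 0) h)
    {c : ℕ} (hc1 : 1 ≤ c) (hc : ∀ k : Fin K, c ≤ (univ.filter (fun r : Fin m => e r = ((0 : Fin (K + 1)), k.succ))).card)
    (f : (Fin (K + 1) → S) → ℝ) {C : ℝ} (hC0 : 0 ≤ C) (hC1 : C * (3 * m) ≤ p * c * t)
    (hC2 : C * (p + 6 * K) ≤ p * γ₀ * (1 - t) * w 0) :
    C * lawVariance (tensorFun μ) f
      ≤ dirichletForm (tensorFun μ) (fun y z : Fin (K + 1) → S => t * ptGraphSwap μ e φ y z + (1 - t) * prodKernel w M y z) f := by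
  have hmpos : (0 : ℝ) < m := Nat.cast_pos.mpr (by omega)
  have hcpos : (0 : ℝ) < c := Nat.cast_pos.mpr (by omega)
  have h1t : 0 < 1 - t := by linarith
  have hW0 : ∀ z, 0 ≤ tensorFun μ z := fun z => (tensorFun_pos hμ z).le
  set V : ℝ := ∑ z : Fin (K + 1) → S, ∑ v, tensorFun μ z * μ 0 v * (f z - f (update z 0 v)) ^ 2 with hV
  set T : ℝ := ∑ r : Fin m, ∑ x : Fin (K + 1) → S,
    min (tensorFun μ x) (tensorFun μ (edgeFlowSwap (φ r) (e r).1 (e r).2 x))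
      * (f x - f (edgeFlowSwap (φ r) (e r).1 (e r).2 x)) ^ 2 with hT
  set U : ℝ := ∑ x : Fin (K + 1) → S, ∑ v, tensorFun μ x * M 0 (x 0) v * (f x - f (update x 0 v)) ^ 2 with hU
  set A : ℝ := dirichletForm (tensorFun μ) (ptGraphSwap μ e φ) f with hA
  set B : ℝ := dirichletForm (tensorFun μ) (prodKernel w M) f with hB
  have hV0 : 0 ≤ V := sum_nonneg fun z _ => sum_nonneg fun v _ => mul_nonneg (mul_nonneg (hW0 z) (hμ _ _).le) (sq_nonneg _)
  have hp0 : p ≠ 0 := hp.ne'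
  have hc0 : (c : ℝ) ≠ 0 := hcpos.ne'
  have hm0 : (m : ℝ) ≠ 0 := hmpos.ne'
  have hγ0 : γ₀ ≠ 0 := hγ₀.ne'
  have hN1 : lawVariance (tensorFun μ) f ≤ (1 / 2 + 3 * K / p) * V + 3 / (2 * p * c) * T :=
    entryGraph_variance_le hμ hμ1 hp e φ hdom hc1 hc f
  have hswap : A = 1 / (2 * m) * T := ptGraph_dirichletForm_swap_eq_min hμ he f
  have hhot : w 0 * (1 / 2 * U) ≤ B := prodKernel_dirichletForm_ge_hot hμ hM hw0 f
  have hVU : V ≤ 1 / γ₀ * U := star_hot_variance_le hμ1 (fun k u => (hμ k u).le) hγ₀ hgap0 f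
  have hsplit : dirichletForm (tensorFun μ) (fun y z : Fin (K + 1) → S =>
      t * ptGraphSwap μ e φ y z + (1 - t) * prodKernel w M y z) f = t * A + (1 - t) * B :=
    weightedScheme_dirichletForm t f
  have k2 : C * (3 / (2 * p * c) * T) ≤ t * A := by
    rw [hswap]
    have h1 : C * (3 / (2 * p * c) * T) = (C * (3 * m)) / (p * c) * (T / (2 * m)) := by
      field_simp
    have h2 : t * (1 / (2 * m) * T) = (p * c * t) / (p * c) * (T / (2 * m)) := by
      field_simp
    have hT0 : 0 ≤ T := sum_nonneg fun r _ => entryEnergy_nonneg hμ e φ f r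
    rw [h1, h2]
    exact mul_le_mul_of_nonneg_right (div_le_div_of_nonneg_right hC1 (by positivity)) (by positivity)
  have k1 : C * ((1 / 2 + 3 * K / p) * V) ≤ (1 - t) * B := by
    have hU' : γ₀ * V ≤ U := by
      have h := mul_le_mul_of_nonneg_left hVU hγ₀.le
      rwa [← mul_assoc, mul_one_div_cancel hγ0, one_mul] at h
    have hB2 : w 0 * U ≤ 2 * B := by linarith [hhot]
    have h5 := mul_le_mul_of_nonneg_left hU' hwhot.le
    have hVB : γ₀ * w 0 * V ≤ 2 * B := by linarith [h5, hB2]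
    have h3 : C * (p + 6 * K) * V ≤ p * γ₀ * (1 - t) * w 0 * V := mul_le_mul_of_nonneg_right hC2 hV0
    have h4 : p * γ₀ * (1 - t) * w 0 * V ≤ p * (1 - t) * (2 * B) := by
      have h := mul_le_mul_of_nonneg_left hVB (mul_nonneg hp.le h1t.le)
      linarith [h]
    have e1 : C * ((1 / 2 + 3 * K / p) * V) = C * (p + 6 * K) * V / (2 * p) := by
      field_simp
      ring
    rw [e1, div_le_iff₀ (by positivity)]
    linarith [h3, h4]
  calc C * lawVariance (tensorFun μ) f ≤ C * ((1 / 2 + 3 * K / p) * V + 3 / (2 * p * c) * T) :=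
        mul_le_mul_of_nonneg_left hN1 hC0
    _ = C * ((1 / 2 + 3 * K / p) * V) + C * (3 / (2 * p * c) * T) := by ring
    _ ≤ (1 - t) * B + t * A := add_le_add k1 k2
    _ = _ := by rw [hsplit]; ring

/-- **THE REGIME-FREE GAP ON A SWAP GRAPH: `Gap ≥ p·min{ct/(3m), γ₀(1−t)w_0/(7K)}`** (`K ≥ 1`, `p ≤ 1`, `|S| ≥ 2`; reversible hot and
cold kernels, `Σw = 1`). [ours] -/
theorem entryGraph_spectralGap_ge [Nontrivial S] (hK : 1 ≤ K) (hm : 1 ≤ m) (he : ∀ r, (e r).1 ≠ (e r).2) (hμ : ∀ k x, 0 < μ k x)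
    (hμ1 : ∀ k, ∑ u, μ k u = 1) (hM : ∀ k, IsRowStochastic (M k)) (hMrev : ∀ k, DetailedBalance (μ k) (M k))
    (hw0 : ∀ k, 0 ≤ w k) (hw1 : ∑ k, w k = 1) (hwhot : 0 < w 0) (ht0 : 0 < t) (ht1 : t < 1) {γ₀ : ℝ} (hp : 0 < p)
    (hp1 : p ≤ 1) (hγ₀ : 0 < γ₀)
    (hdom : ∀ (r : Fin m) (k : Fin K), e r = ((0 : Fin (K + 1)), k.succ) → ∀ u : S, p * μ k.succ (φ r u) ≤ μ 0 u)
    (hgap0 : ∀ h : S → ℝ, γ₀ * lawVariance (μ 0) h ≤ dirichletForm (μ 0) (M 0) h)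
    {c : ℕ} (hc1 : 1 ≤ c) (hc : ∀ k : Fin K, c ≤ (univ.filter (fun r : Fin m => e r = ((0 : Fin (K + 1)), k.succ))).card) :
    p * min (c * t / (3 * m)) (γ₀ * (1 - t) * w 0 / (7 * K))
      ≤ spectralGap (tensorFun μ) (fun y z : Fin (K + 1) → S => t * ptGraphSwap μ e φ y z + (1 - t) * prodKernel w M y z) := by
  have hKr : (1 : ℝ) ≤ K := by exact_mod_cast hK
  have hmpos : (0 : ℝ) < m := Nat.cast_pos.mpr (by omega)
  have hcpos : (0 : ℝ) < c := Nat.cast_pos.mpr (by omega)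
  have h1t : 0 < 1 - t := by linarith
  have hm0 : (m : ℝ) ≠ 0 := hmpos.ne'
  have hK0 : (K : ℝ) ≠ 0 := by positivity
  set m₀ := min (c * t / (3 * m)) (γ₀ * (1 - t) * w 0 / (7 * K)) with hm₀
  refine le_spectralGap_of_poincare (tensorFun_pos hμ) (sum_tensorFun_eq_one μ hμ1)
    (weightedScheme_isRowStochastic (ptGraphSwap_isRowStochastic hμ) hM hw0 hw1 ht0.le ht1.le)
    (weightedScheme_detailedBalance (ptGraphSwap_detailedBalance hμ) hMrev t) fun f => ?_
  refine entryGraph_poincare e φ hm he hμ hμ1 hM hw0 hwhot ht0 ht1 hp hγ₀ hdom hgap0 hc1 hc f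
    (mul_nonneg hp.le (le_min (by positivity) (by positivity))) ?_ ?_
  · have h1 : m₀ ≤ c * t / (3 * m) := min_le_left _ _
    calc p * m₀ * (3 * m) ≤ p * (c * t / (3 * m)) * (3 * m) :=
          mul_le_mul_of_nonneg_right (mul_le_mul_of_nonneg_left h1 hp.le) (by positivity)
      _ = p * c * t := by field_simp
  · have h2 : m₀ ≤ γ₀ * (1 - t) * w 0 / (7 * K) := min_le_right _ _
    have h3 : (p + 6 * (K : ℝ)) ≤ 7 * K := by nlinarith
    have h4 : m₀ * (p + 6 * K) ≤ γ₀ * (1 - t) * w 0 / (7 * K) * (7 * K) :=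
      mul_le_mul h2 h3 (by positivity) (by positivity)
    calc p * m₀ * (p + 6 * K) = p * (m₀ * (p + 6 * K)) := by ring
      _ ≤ p * (γ₀ * (1 - t) * w 0 / (7 * K) * (7 * K)) := mul_le_mul_of_nonneg_left h4 hp.le
      _ = p * γ₀ * (1 - t) * w 0 := by field_simp

/-! ## §2 Irreducibility and `τ_int` on an arbitrary swap graph -/

/-- **A swap graph with per-entry maps listing every hub edge is irreducible as soon as the hot update is** (`0 < t < 1`, `w ≥ 0`,
`Σw = 1`, `w_0 > 0`, positive laws, distinct endpoints; cold updates arbitrary transition matrices). [ours] -/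
theorem entryGraph_isIrreducible_of_hot (he : ∀ r, (e r).1 ≠ (e r).2)
    (hhub : ∀ k : Fin K, ∃ r, e r = ((0 : Fin (K + 1)), k.succ)) (hμ : ∀ k x, 0 < μ k x)
    (hM : ∀ k, IsRowStochastic (M k)) (hM0 : Literature.Probability.MarkovChains.IsIrreducible (M 0))
    (hw0 : ∀ k, 0 ≤ w k) (hw1 : ∑ k, w k = 1) (hwhot : 0 < w 0) (ht0 : 0 < t) (ht1 : t < 1) :
    Literature.Probability.MarkovChains.IsIrreducible (fun x y : Fin (K + 1) → S =>
      t * ptGraphSwap μ e φ x y + (1 - t) * prodKernel w M x y) := by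
  have hQ := ptGraphSwap_isRowStochastic (e := e) (φ := φ) hμ
  have hP0 := (weightedScheme_isRowStochastic hQ hM hw0 hw1 ht0.le ht1.le).1
  refine isIrreducible_of_forall_closed hP0 fun T hT hcl => ?_
  have moveA : ∀ (x : Fin (K + 1) → S) (v : S), x ∈ T → 0 < M 0 (x 0) v → update x 0 v ∈ T := by
    intro x v hx hv
    by_cases hvx : v = x 0
    · rw [hvx, update_eq_self]; exact hx
    refine hcl x hx (update x 0 v) ?_
    have h := whub_hot_flow_ge (M := M) (w := w) (t := t) hQ.1 hμ ht0.le x hvx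
    have hpos : 0 < (1 - t) * w 0 * (tensorFun μ x * M 0 (x 0) v) :=
      mul_pos (mul_pos (by linarith) hwhot) (mul_pos (tensorFun_pos hμ x) hv)
    exact (mul_pos_iff_of_pos_left (tensorFun_pos hμ x)).mp (lt_of_lt_of_le hpos h)
  have moveB : ∀ x : Fin (K + 1) → S, x ∈ T → ∀ v, update x 0 v ∈ T := by
    intro x hx v
    set V : Finset S := univ.filter fun u => update x 0 u ∈ T with hV
    have hxk : x 0 ∈ V := by rw [hV, Finset.mem_filter, update_eq_self]; exact ⟨mem_univ _, hx⟩
    have hclV : ∀ u ∈ V, ∀ u', 0 < M 0 u u' → u' ∈ V := by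
      intro u hu u' huu'
      rw [hV, Finset.mem_filter] at hu ⊢
      refine ⟨mem_univ _, ?_⟩
      have h := moveA (update x 0 u) u' hu.2 (by rwa [update_self])
      rwa [update_idem] at h
    have hVu := hM0.eq_univ_of_closed (hM 0).1 ⟨x 0, hxk⟩ hclV
    have hv : v ∈ V := by rw [hVu]; exact mem_univ _
    rw [hV, Finset.mem_filter] at hv
    exact hv.2
  have swapPos : ∀ (x : Fin (K + 1) → S) (r : Fin m), x ∈ T → edgeFlowSwap (φ r) (e r).1 (e r).2 x ∈ T := by
    intro x r hx
    by_cases hxr : edgeFlowSwap (φ r) (e r).1 (e r).2 x = x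
    · rw [hxr]; exact hx
    refine hcl x hx _ ?_
    have hflow := tensorFun_mul_ptGraphSwap (e := e) (φ := φ) hμ he hxr
    have hprop := ptGraphProposal_edge_ge e φ r x
    have hmm : 0 < m := by have := r.2; omega
    have hsw : 0 < tensorFun μ x * ptGraphSwap μ e φ x (edgeFlowSwap (φ r) (e r).1 (e r).2 x) := by
      rw [hflow]
      exact mul_pos (lt_of_lt_of_le (div_pos one_pos (by exact_mod_cast hmm)) hprop)
        (lt_min (tensorFun_pos hμ _) (tensorFun_pos hμ _))
    have hsw' : 0 < ptGraphSwap μ e φ x (edgeFlowSwap (φ r) (e r).1 (e r).2 x) :=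
      (mul_pos_iff_of_pos_left (tensorFun_pos hμ x)).mp hsw
    have hpr : 0 ≤ prodKernel w M x (edgeFlowSwap (φ r) (e r).1 (e r).2 x) :=
      (prodKernel_isRowStochastic M w hw0 hw1 hM).1 _ _
    exact add_pos_of_pos_of_nonneg (mul_pos ht0 hsw') (mul_nonneg (by linarith) hpr)
  have moveD : ∀ (k : Fin (K + 1)) (x : Fin (K + 1) → S), x ∈ T → ∀ v, update x k v ∈ T := by
    intro k
    induction k using Fin.cases with
    | zero => exact moveB
    | succ l =>
      intro x hx v
      obtain ⟨r, hr⟩ := hhub l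
      have hsw := swapPos (update x 0 ((φ r).symm v)) r (moveB x hx _)
      rw [hr] at hsw
      rw [update_eq_mapRotation x (Fin.succ_ne_zero l) (φ r) v]
      exact moveB _ hsw _
  obtain ⟨x₀, hx₀⟩ := hT
  have key : ∀ (y : Fin (K + 1) → S) (s : Finset (Fin (K + 1))), s.piecewise y x₀ ∈ T := by
    intro y s
    induction s using Finset.induction_on with
    | empty => rwa [Finset.piecewise_empty]
    | insert k s hk ih =>
      rw [Finset.piecewise_insert]
      exact moveD k _ ih _
  refine Finset.eq_univ_of_forall fun y => ?_
  have h := key y univ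
  rwa [Finset.piecewise_univ] at h

omit [DecidableEq S] in
/-- A multiplicity floor `c ≥ 1` on the hub edges makes the list reach every hub edge. [ours] -/
theorem graph_hubEdge_of_mult {c : ℕ} (hc1 : 1 ≤ c)
    (hc : ∀ k : Fin K, c ≤ (univ.filter (fun r : Fin m => e r = ((0 : Fin (K + 1)), k.succ))).card) (k : Fin K) :
    ∃ r, e r = ((0 : Fin (K + 1)), k.succ) := by
  have hne : (univ.filter (fun r : Fin m => e r = ((0 : Fin (K + 1)), k.succ))).Nonempty := by
    rw [← Finset.card_pos]; exact lt_of_lt_of_le (by omega) (hc k)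
  obtain ⟨r, hr⟩ := hne
  exact ⟨r, (Finset.mem_filter.mp hr).2⟩

/-- **`τ_int(g) ≤ 1/(p·min{ct/(3m), γ₀(1−t)w_0/(7K)}) − ½` FOR EVERY OBSERVABLE ON AN ARBITRARY SWAP GRAPH WITH PER-ENTRY MAPS, NO REGIME**
(hot update `μ_0`-reversible, irreducible, Poincaré constant `γ₀`; cold updates `μ_k`-reversible; hub edges listed `≥ c ≥ 1` times with
one-sided transported domination there; `Var_π̃(g) > 0`). [ours] -/
theorem entryGraph_tauInt_le [Nontrivial S] (hK : 1 ≤ K) (hm : 1 ≤ m) (he : ∀ r, (e r).1 ≠ (e r).2) (hμ : ∀ k x, 0 < μ k x)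
    (hμ1 : ∀ k, ∑ u, μ k u = 1) (hM : ∀ k, IsRowStochastic (M k)) (hMrev : ∀ k, DetailedBalance (μ k) (M k))
    (hM0 : Literature.Probability.MarkovChains.IsIrreducible (M 0)) (hw0 : ∀ k, 0 ≤ w k) (hw1 : ∑ k, w k = 1)
    (hwhot : 0 < w 0) (ht0 : 0 < t) (ht1 : t < 1) {γ₀ : ℝ} (hp : 0 < p) (hp1 : p ≤ 1) (hγ₀ : 0 < γ₀)
    (hdom : ∀ (r : Fin m) (k : Fin K), e r = ((0 : Fin (K + 1)), k.succ) → ∀ u : S, p * μ k.succ (φ r u) ≤ μ 0 u)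
    (hgap0 : ∀ h : S → ℝ, γ₀ * lawVariance (μ 0) h ≤ dirichletForm (μ 0) (M 0) h)
    {c : ℕ} (hc1 : 1 ≤ c) (hc : ∀ k : Fin K, c ≤ (univ.filter (fun r : Fin m => e r = ((0 : Fin (K + 1)), k.succ))).card)
    {g : (Fin (K + 1) → S) → ℝ} (hg : 0 < lawVariance (tensorFun μ) g) :
    asympVar g (tensorFun μ) (fun y z : Fin (K + 1) → S => t * ptGraphSwap μ e φ y z + (1 - t) * prodKernel w M y z)
        / (2 * lawVariance (tensorFun μ) g)
      ≤ 1 / (p * min (c * t / (3 * m)) (γ₀ * (1 - t) * w 0 / (7 * K))) - 1 / 2 := by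
  have hKpos : (0 : ℝ) < K := Nat.cast_pos.mpr (by omega)
  have hmpos : (0 : ℝ) < m := Nat.cast_pos.mpr (by omega)
  have hcpos : (0 : ℝ) < c := Nat.cast_pos.mpr (by omega)
  have h1t : 0 < 1 - t := by linarith
  have hc0 : 0 < p * min (c * t / (3 * m)) (γ₀ * (1 - t) * w 0 / (7 * K)) :=
    mul_pos hp (lt_min (by positivity) (by positivity))
  exact tauInt_le_of_gapFloor (tensorFun_pos hμ) (sum_tensorFun_eq_one μ hμ1)
    (weightedScheme_isRowStochastic (ptGraphSwap_isRowStochastic hμ) hM hw0 hw1 ht0.le ht1.le)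
    (weightedScheme_detailedBalance (ptGraphSwap_detailedBalance hμ) hMrev t)
    (entryGraph_isIrreducible_of_hot e φ he (graph_hubEdge_of_mult e hc1 hc) hμ hM hM0 hw0 hw1 hwhot ht0 ht1) hc0
    (entryGraph_spectralGap_ge e φ hK hm he hμ hμ1 hM hMrev hw0 hw1 hwhot ht0 ht1 hp hp1 hγ₀ hdom hgap0 hc1 hc) hg

/-- **EXACT HOT SAMPLER ON A SWAP GRAPH: `Gap ≥ p·min{ct/(3m), (1−t)w_0/(7K)}`** (`M_0(u,·) = μ_0`). [ours] -/
theorem exactEntryGraph_spectralGap_ge [Nontrivial S] (hK : 1 ≤ K) (hm : 1 ≤ m) (he : ∀ r, (e r).1 ≠ (e r).2)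
    (hμ : ∀ k x, 0 < μ k x) (hμ1 : ∀ k, ∑ u, μ k u = 1) (hM : ∀ k, IsRowStochastic (M k))
    (hMrev : ∀ k, DetailedBalance (μ k) (M k)) (hM0 : ∀ u v, M 0 u v = μ 0 v) (hw0 : ∀ k, 0 ≤ w k) (hw1 : ∑ k, w k = 1)
    (hwhot : 0 < w 0) (ht0 : 0 < t) (ht1 : t < 1) (hp : 0 < p) (hp1 : p ≤ 1)
    (hdom : ∀ (r : Fin m) (k : Fin K), e r = ((0 : Fin (K + 1)), k.succ) → ∀ u : S, p * μ k.succ (φ r u) ≤ μ 0 u)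
    {c : ℕ} (hc1 : 1 ≤ c) (hc : ∀ k : Fin K, c ≤ (univ.filter (fun r : Fin m => e r = ((0 : Fin (K + 1)), k.succ))).card) :
    p * min (c * t / (3 * m)) ((1 - t) * w 0 / (7 * K))
      ≤ spectralGap (tensorFun μ) (fun y z : Fin (K + 1) → S => t * ptGraphSwap μ e φ y z + (1 - t) * prodKernel w M y z) := by
  have h := entryGraph_spectralGap_ge e φ hK hm he hμ hμ1 hM hMrev hw0 hw1 hwhot ht0 ht1 hp hp1 one_pos hdom
    (exactSampler_poincare_one (hμ1 0) hM0) hc1 hc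
  simpa only [one_mul] using h

/-- **EXACT HOT SAMPLER ON A SWAP GRAPH: `τ_int(g) ≤ 1/(p·min{ct/(3m), (1−t)w_0/(7K)}) − ½`** for every observable. [ours] -/
theorem exactEntryGraph_tauInt_le [Nontrivial S] (hK : 1 ≤ K) (hm : 1 ≤ m) (he : ∀ r, (e r).1 ≠ (e r).2)
    (hμ : ∀ k x, 0 < μ k x) (hμ1 : ∀ k, ∑ u, μ k u = 1) (hM : ∀ k, IsRowStochastic (M k))
    (hMrev : ∀ k, DetailedBalance (μ k) (M k)) (hM0 : ∀ u v, M 0 u v = μ 0 v) (hw0 : ∀ k, 0 ≤ w k) (hw1 : ∑ k, w k = 1)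
    (hwhot : 0 < w 0) (ht0 : 0 < t) (ht1 : t < 1) (hp : 0 < p) (hp1 : p ≤ 1)
    (hdom : ∀ (r : Fin m) (k : Fin K), e r = ((0 : Fin (K + 1)), k.succ) → ∀ u : S, p * μ k.succ (φ r u) ≤ μ 0 u)
    {c : ℕ} (hc1 : 1 ≤ c) (hc : ∀ k : Fin K, c ≤ (univ.filter (fun r : Fin m => e r = ((0 : Fin (K + 1)), k.succ))).card)
    {g : (Fin (K + 1) → S) → ℝ} (hg : 0 < lawVariance (tensorFun μ) g) :
    asympVar g (tensorFun μ) (fun y z : Fin (K + 1) → S => t * ptGraphSwap μ e φ y z + (1 - t) * prodKernel w M y z)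
        / (2 * lawVariance (tensorFun μ) g)
      ≤ 1 / (p * min (c * t / (3 * m)) ((1 - t) * w 0 / (7 * K))) - 1 / 2 := by
  have hirr0 : Literature.Probability.MarkovChains.IsIrreducible (M 0) :=
    fun u v => ⟨1, by rw [pow_one, hM0]; exact hμ 0 v⟩
  have h := entryGraph_tauInt_le e φ hK hm he hμ hμ1 hM hMrev hirr0 hw0 hw1 hwhot ht0 ht1 hp hp1 one_pos hdom
    (exactSampler_poincare_one (hμ1 0) hM0) hc1 hc hg
  simpa only [one_mul] using h

end Graph

end Summit.Ventures.LatticeQCDFlow.Scaling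

end
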